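import Summits.CriticalPhenomena.Ising3DConformalLimit.Theses.PrecisionLaplacian
import Summits.CriticalPhenomena.Ising3DConformalLimit.Theorems.MoebiusLimitOfTwoPointLaw.Negative.GroupLemmaNeedsTranslation
import HarnessLib

/-!
# Sphere-inversion covariance from the two-shell exchange: the FREE configurations (line
`two-shell-exchange-markov` of crux `MoebiusLimitOfTwoPointLaw`, item stmt-CriticalPhenomena-4801; helper for stub
`stub_traceReversibility`)

The registered stub K2 (`stub_traceReversibility`, skeleton
`Cruxes/MoebiusLimitOfTwoPointLaw/Lines/two_shell_exchange_markov.lean`) lifts the two-shell exchange hierarchy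
`S ∈ Negative.twoShellExchange Δ` (two-time symmetry of the sphere chain) to covariance under every origin-centred
sphere inversion `ι_λ : x ↦ λx/‖x‖²`, `S ∈ Negative.sphereInversionCovariant Δ` (reversibility), using the
germ-Markov law of the limit field. This file proves, `sorry`-free, the part of that lift that needs NO Markov
input, and isolates the rest:

* `sphereInversion_twoShell`: on a configuration lying on at most TWO origin-centred spheres
  (`x_i = (inner ↦ a, outer ↦ b) • u_i`, unit `u_i`), `ι_λ` IS the exchange of the two shells followed by the
  dilation `λ/(ab)`; so `twoShellExchange` + `IsScaleCovariant Δ` give the `ι_λ`-identity there, with the weights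
  matching exactly (`(a/b)^{(k−m)Δ}(λ/(ab))^{−nΔ} = λ^{−nΔ} a^{2kΔ} b^{2mΔ}`, `weight_twoShell`);
* `sphereInversion_of_odd`: odd arities (both sides vanish);
* `twoShell_of_le_two`: every configuration of `n ≤ 2` points off the origin is a two-shell configuration;
* `mem_sphereInversionCovariant_iff_core`: for a family with vanishing odd arities, scale covariant and in
  `twoShellExchange Δ`, membership in `sphereInversionCovariant Δ` is EQUIVALENT to the `ι_λ`-identities at even
  arities `n ≥ 4` on configurations that are NOT two-shell (at least three distinct radii) — the configurations on
  which the exchange hierarchy is silent (Disproof §3c) and only the Markov structure of the limit law could act;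
  the tree has no trace/restriction theory of field laws on spheres to make it act (K2's open core).

References: crux workfile `Cruxes/MoebiusLimitOfTwoPointLaw/Disproof.lean` §3a (`kinematicNecessity`,
`sphereInversionGivesExchange`) and §3c; Kelly, *Reversibility and Stochastic Networks* (1979) ch. 1 (two-time
symmetry vs reversibility) [Kelly1979]; Di Francesco–Mathieu–Sénéchal 1997 §4.3.1 [FrancescoMathieuSenechal1997].
-/

noncomputable section

namespace Summit.CriticalPhenomena.Ising3DConformalLimit.PrecisionLaplacianMoebiusLimitOfTwoPointLaw

open Literature.Probability.LatticeModels Filter Topology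
open Summit.CriticalPhenomena.Ising3DConformalLimit.Theorems.MoebiusLimitOfTwoPointLaw.Negative
  (twoShellExchange sphereInversionCovariant)

variable {Δ : ℝ} {S : CorrFamily 3}

/-- Membership in `sphereInversionCovariant Δ`, unfolded (by `Iff.rfl`). -/
theorem mem_sphereInversionCovariant_iff :
    S ∈ sphereInversionCovariant Δ ↔ ∀ (n : ℕ) (lam : ℝ), 0 < lam →
      ∀ x : Fin n → EuclideanSpace ℝ (Fin 3), (∀ i, x i ≠ 0) →
        S n (fun i => (lam / ‖x i‖ ^ 2) • x i) = lam ^ (-(n : ℝ) * Δ) * (∏ i, ‖x i‖ ^ (2 * Δ)) * S n x :=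
  Iff.rfl

/-! ## Two-shell configurations -/

/-- Norm of a point of a two-shell configuration. -/
theorem norm_twoShell {n : ℕ} {a b : ℝ} (ha : 0 < a) (hb : 0 < b) {u : Fin n → EuclideanSpace ℝ (Fin 3)}
    (hu : ∀ i, ‖u i‖ = 1) (inner : Fin n → Bool) (i : Fin n) :
    ‖(if inner i then a else b) • u i‖ = if inner i then a else b := by
  split_ifs with h
  · rw [norm_smul, Real.norm_eq_abs, abs_of_pos ha, hu i, mul_one]
  · rw [norm_smul, Real.norm_eq_abs, abs_of_pos hb, hu i, mul_one]

/-- `ι_λ` maps the two-shell configuration with radii `(a, b)` to the two-shell configuration with radii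
`(λ/a, λ/b)` on the same rays. -/
theorem sphereInversion_apply_twoShell {n : ℕ} {a b lam : ℝ} (ha : 0 < a) (hb : 0 < b)
    {u : Fin n → EuclideanSpace ℝ (Fin 3)} (hu : ∀ i, ‖u i‖ = 1) (inner : Fin n → Bool) :
    (fun i => (lam / ‖(if inner i then a else b) • u i‖ ^ 2) • ((if inner i then a else b) • u i)) =
      fun i => (if inner i then lam / a else lam / b) • u i := by
  funext i
  rw [norm_twoShell ha hb hu inner i, smul_smul]
  congr 1
  split_ifs
  · field_simp
  · field_simp

/-- The weight bookkeeping: `(a'/b')^{(k-m)Δ} · (λ/(ab))^{-nΔ} = λ^{-nΔ} ∏ ‖x_i‖^{2Δ}` for the exchanged radii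
`a' = λ/b`, `b' = λ/a` of a two-shell configuration with `k` inner and `m` outer points, `k + m = n`. -/
theorem weight_twoShell {n : ℕ} {a b lam : ℝ} (ha : 0 < a) (hb : 0 < b) (hlam : 0 < lam)
    {u : Fin n → EuclideanSpace ℝ (Fin 3)} (hu : ∀ i, ‖u i‖ = 1) (inner : Fin n → Bool) :
    ((lam / b) / (lam / a)) ^ ((((Finset.univ.filter fun i => inner i = true).card : ℝ)
        - ((Finset.univ.filter fun i => inner i = false).card : ℝ)) * Δ)
      * (lam / (a * b)) ^ (-(n : ℝ) * Δ) =
    lam ^ (-(n : ℝ) * Δ) * ∏ i, ‖(if inner i then a else b) • u i‖ ^ (2 * Δ) := by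
  -- the product of the norms
  have hprod : (∏ i, ‖(if inner i then a else b) • u i‖ ^ (2 * Δ)) =
      (a ^ (2 * Δ)) ^ (Finset.univ.filter fun i => inner i = true).card *
        (b ^ (2 * Δ)) ^ (Finset.univ.filter fun i => inner i = false).card := by
    have h1 : (∏ i, ‖(if inner i then a else b) • u i‖ ^ (2 * Δ)) =
        ∏ i, (if inner i = true then a ^ (2 * Δ) else b ^ (2 * Δ)) := by
      refine Finset.prod_congr rfl fun i _ => ?_
      rw [norm_twoShell ha hb hu inner i]
      split_ifs <;> rfl
    rw [h1, Finset.prod_ite, Finset.prod_const, Finset.prod_const]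
    simp only [Bool.not_eq_true]
  set k : ℕ := (Finset.univ.filter fun i => inner i = true).card with hk
  set m : ℕ := (Finset.univ.filter fun i => inner i = false).card with hm
  have hkm : (k : ℝ) + m = n := by
    have h := Finset.card_filter_add_card_filter_not (s := (Finset.univ : Finset (Fin n)))
      (fun i => inner i = true)
    simp only [Finset.card_univ, Fintype.card_fin, Bool.not_eq_true] at h
    rw [← hk, ← hm] at h
    exact_mod_cast h
  have hab : 0 < a * b := mul_pos ha hb
  have hratio : (lam / b) / (lam / a) = a / b := by field_simp
  rw [hprod, hratio, ← Real.rpow_mul_natCast ha.le, ← Real.rpow_mul_natCast hb.le,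
    Real.div_rpow ha.le hb.le, Real.div_rpow hlam.le hab.le, Real.mul_rpow ha.le hb.le]
  have hbpos : (0 : ℝ) < b ^ ((k - m : ℝ) * Δ) := Real.rpow_pos_of_pos hb _
  have hapow : (0 : ℝ) < a ^ (-(n : ℝ) * Δ) := Real.rpow_pos_of_pos ha _
  have hbpow : (0 : ℝ) < b ^ (-(n : ℝ) * Δ) := Real.rpow_pos_of_pos hb _
  rw [div_mul_div_comm, div_eq_iff (mul_pos hbpos (mul_pos hapow hbpow)).ne']
  -- compare exponents of `a` and `b`
  have ea : a ^ ((k - m : ℝ) * Δ) = a ^ (2 * Δ * k) * a ^ (-(n : ℝ) * Δ) := by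
    rw [← Real.rpow_add ha]; congr 1; rw [← hkm]; ring
  have eb : b ^ (2 * Δ * m) * b ^ ((k - m : ℝ) * Δ) * b ^ (-(n : ℝ) * Δ) = 1 := by
    rw [← Real.rpow_add hb, ← Real.rpow_add hb, ← hkm]
    convert Real.rpow_zero b using 2
    ring
  calc a ^ ((k - m : ℝ) * Δ) * lam ^ (-(n : ℝ) * Δ)
      = a ^ ((k - m : ℝ) * Δ) * lam ^ (-(n : ℝ) * Δ) * (b ^ (2 * Δ * m) * b ^ ((k - m : ℝ) * Δ) * b ^ (-(n : ℝ) * Δ)) := by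
        rw [eb, mul_one]
    _ = lam ^ (-(n : ℝ) * Δ) * (a ^ (2 * Δ * k) * b ^ (2 * Δ * m)) *
          (b ^ ((k - m : ℝ) * Δ) * (a ^ (-(n : ℝ) * Δ) * b ^ (-(n : ℝ) * Δ))) := by
        rw [ea]; ring

/-- **Two-shell configurations are free.** On a configuration lying on at most two origin-centred spheres, the
two-shell exchange hierarchy plus scale covariance give the `ι_λ`-identity: `ι_λ` of the configuration with radii
`(a, b)` is the configuration with radii `(λ/a, λ/b)`, which the exchange `E` turns into the one with radii
`(λ/b, λ/a) = (λ/(ab)) • (a, b)`, a dilation of the original. -/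
theorem sphereInversion_twoShell (hsc : IsScaleCovariant Δ S) (hex : S ∈ twoShellExchange Δ)
    {n : ℕ} {a b lam : ℝ} (ha : 0 < a) (hb : 0 < b) (hlam : 0 < lam)
    {u : Fin n → EuclideanSpace ℝ (Fin 3)} (hu : ∀ i, ‖u i‖ = 1) (inner : Fin n → Bool) :
    S n (fun i => (lam / ‖(if inner i then a else b) • u i‖ ^ 2) • ((if inner i then a else b) • u i)) =
      lam ^ (-(n : ℝ) * Δ) * (∏ i, ‖(if inner i then a else b) • u i‖ ^ (2 * Δ)) *
        S n (fun i => (if inner i then a else b) • u i) := by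
  rw [sphereInversion_apply_twoShell ha hb hu inner]
  -- exchange the shells of radii `λ/a` (inner) and `λ/b` (outer)
  have hE := hex n (lam / b) (lam / a) (div_pos hlam hb) (div_pos hlam ha) u inner hu
  -- `hE : S n (inner ↦ λ/a, outer ↦ λ/b) = ((λ/b)/(λ/a))^{(k-m)Δ} * S n (inner ↦ λ/b, outer ↦ λ/a)`
  rw [hE]
  -- the exchanged configuration is the dilation by `λ/(ab)` of the original one
  have hdil : (fun i => (if inner i then lam / b else lam / a) • u i) =
      fun i => (lam / (a * b)) • ((if inner i then a else b) • u i) := by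
    funext i
    rw [smul_smul]
    congr 1
    split_ifs
    · field_simp
    · field_simp
  rw [hdil, hsc n (lam / (a * b)) (div_pos hlam (mul_pos ha hb)), ← mul_assoc,
    weight_twoShell ha hb hlam hu inner]

/-- Odd arities: both sides of the `ι_λ`-identity vanish. -/
theorem sphereInversion_of_odd (hodd : ∀ n, Odd n → ∀ x : Fin n → EuclideanSpace ℝ (Fin 3), S n x = 0)
    {n : ℕ} (hn : Odd n) (lam : ℝ) (x : Fin n → EuclideanSpace ℝ (Fin 3)) :
    S n (fun i => (lam / ‖x i‖ ^ 2) • x i) = lam ^ (-(n : ℝ) * Δ) * (∏ i, ‖x i‖ ^ (2 * Δ)) * S n x := by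
  rw [hodd n hn, hodd n hn, mul_zero]

/-- Every configuration of at most two points off the origin is a two-shell configuration. -/
theorem twoShell_of_le_two {n : ℕ} (hn : n ≤ 2) (x : Fin n → EuclideanSpace ℝ (Fin 3)) (hx : ∀ i, x i ≠ 0) :
    ∃ (a b : ℝ) (u : Fin n → EuclideanSpace ℝ (Fin 3)) (inner : Fin n → Bool),
      0 < a ∧ 0 < b ∧ (∀ i, ‖u i‖ = 1) ∧ x = fun i => (if inner i then a else b) • u i := by
  have hunit : ∀ i, ‖‖x i‖⁻¹ • x i‖ = 1 := fun i => by
    rw [norm_smul, norm_inv, norm_norm, inv_mul_cancel₀ (norm_ne_zero_iff.2 (hx i))]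
  have hself : ∀ i, ‖x i‖ • (‖x i‖⁻¹ • x i) = x i := fun i => by
    rw [smul_smul, mul_inv_cancel₀ (norm_ne_zero_iff.2 (hx i)), one_smul]
  interval_cases n
  · exact ⟨1, 1, fun i => Fin.elim0 i, fun i => Fin.elim0 i, one_pos, one_pos, fun i => Fin.elim0 i,
      funext fun i => Fin.elim0 i⟩
  · refine ⟨‖x 0‖, 1, fun i => ‖x i‖⁻¹ • x i, fun _ => true, norm_pos_iff.2 (hx 0), one_pos, hunit, ?_⟩
    funext i
    fin_cases i
    simp only [if_true]
    exact (hself 0).symm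
  · refine ⟨‖x 0‖, ‖x 1‖, fun i => ‖x i‖⁻¹ • x i, fun i => decide (i = 0), norm_pos_iff.2 (hx 0),
      norm_pos_iff.2 (hx 1), hunit, ?_⟩
    funext i
    fin_cases i
    · simp only [Fin.zero_eta, decide_true, if_true]
      exact (hself 0).symm
    · simp only [Fin.mk_one, Fin.isValue, one_ne_zero, decide_false, Bool.false_eq_true, if_false]
      exact (hself 1).symm

/-- **K2 reduces to its core.** For a family whose odd arities vanish, which is scale covariant with dimension
`Δ` and satisfies the two-shell exchange hierarchy, membership in `sphereInversionCovariant Δ` is EQUIVALENT to the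
`ι_λ`-identities at even arities `n ≥ 4` on configurations off the origin that are NOT two-shell configurations
(at least three distinct radii) — exactly the configurations on which the exchange hierarchy is silent and the
Markov lift of stub `stub_traceReversibility` would have to act. -/
theorem mem_sphereInversionCovariant_iff_core
    (hodd : ∀ n, Odd n → ∀ x : Fin n → EuclideanSpace ℝ (Fin 3), S n x = 0)
    (hsc : IsScaleCovariant Δ S) (hex : S ∈ twoShellExchange Δ) :
    S ∈ sphereInversionCovariant Δ ↔
      ∀ (n : ℕ), Even n → 4 ≤ n → ∀ (lam : ℝ), 0 < lam →
        ∀ x : Fin n → EuclideanSpace ℝ (Fin 3), (∀ i, x i ≠ 0) →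
          (¬ ∃ (a b : ℝ) (u : Fin n → EuclideanSpace ℝ (Fin 3)) (inner : Fin n → Bool),
              0 < a ∧ 0 < b ∧ (∀ i, ‖u i‖ = 1) ∧ x = fun i => (if inner i then a else b) • u i) →
          S n (fun i => (lam / ‖x i‖ ^ 2) • x i) = lam ^ (-(n : ℝ) * Δ) * (∏ i, ‖x i‖ ^ (2 * Δ)) * S n x := by
  rw [mem_sphereInversionCovariant_iff]
  constructor
  · intro h n _ _ lam hlam x hx _
    exact h n lam hlam x hx
  · intro h n lam hlam x hx
    -- two-shell configurations are free in every arity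
    by_cases hshell : ∃ (a b : ℝ) (u : Fin n → EuclideanSpace ℝ (Fin 3)) (inner : Fin n → Bool),
        0 < a ∧ 0 < b ∧ (∀ i, ‖u i‖ = 1) ∧ x = fun i => (if inner i then a else b) • u i
    · obtain ⟨a, b, u, inner, ha, hb, hu, rfl⟩ := hshell
      exact sphereInversion_twoShell hsc hex ha hb hlam hu inner
    rcases Nat.even_or_odd n with hev | hodd'
    · by_cases h4 : 4 ≤ n
      · exact h n hev h4 lam hlam x hx hshell
      · -- even n < 4: n ≤ 2, always two-shell
        exfalso
        push Not at h4
        have hn2 : n ≤ 2 := by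
          interval_cases n
          · exact Nat.zero_le _
          · exact absurd hev (by decide)
          · exact le_rfl
          · exact absurd hev (by decide)
        exact hshell (twoShell_of_le_two hn2 x hx)
    · exact sphereInversion_of_odd hodd hodd' lam x

/-- **Registered lead sub-goal (free part of stub `stub_traceReversibility`).** For a family with vanishing odd
arities, scale covariant with dimension `Δ` and in `twoShellExchange Δ`, the `ι_λ`-identity holds at every odd
arity and on every two-shell configuration. -/
theorem stub_traceReversibility_free :
    ∀ (Δ : ℝ) (S : CorrFamily 3), (∀ n, Odd n → ∀ x : Fin n → EuclideanSpace ℝ (Fin 3), S n x = 0) →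
      IsScaleCovariant Δ S → S ∈ twoShellExchange Δ →
      ∀ (n : ℕ) (lam : ℝ), 0 < lam → ∀ x : Fin n → EuclideanSpace ℝ (Fin 3), (∀ i, x i ≠ 0) →
        (Odd n ∨ ∃ (a b : ℝ) (u : Fin n → EuclideanSpace ℝ (Fin 3)) (inner : Fin n → Bool),
            0 < a ∧ 0 < b ∧ (∀ i, ‖u i‖ = 1) ∧ x = fun i => (if inner i then a else b) • u i) →
        S n (fun i => (lam / ‖x i‖ ^ 2) • x i) = lam ^ (-(n : ℝ) * Δ) * (∏ i, ‖x i‖ ^ (2 * Δ)) * S n x := by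
  intro Δ S hodd hsc hex n lam hlam x hx hcase
  rcases hcase with hn | ⟨a, b, u, inner, ha, hb, hu, rfl⟩
  · exact sphereInversion_of_odd hodd hn lam x
  · exact sphereInversion_twoShell hsc hex ha hb hlam hu inner

end Summit.CriticalPhenomena.Ising3DConformalLimit.PrecisionLaplacianMoebiusLimitOfTwoPointLaw

end
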